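import Literature.AnabelianGeometry.EtaleTheta.Discharge.Sec2TemperedCoverDataModel
import HarnessLib

/-!
# A TWISTED variant of the NV-L2 model of `ThetaCovers.TemperedCoverData` ([EtTh] §2, Def 2.5), part 1:
# carriers, coordinates, the profinite cover data `CoverDataAx` (with a NON-normal cusp decomposition group)

S. Mochizuki, *The étale theta function and its Frobenioid-theoretic manifestations*, Publ. RIMS **45** (2009)
[MochizukiEtTh2009], §2: Def. 2.1 – Prop. 2.2 (pp.35–38, PDF), Def. 2.5 (pp.39–40), Cor. 2.9 (p.43).  abc-iut
cell, block F (fact-proving wave), seat abc-iut-f-142, FACT-LIST row F-0601 (`TemperedCoverData.Cor29_preserved`,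
the typed last sentence of Cor. 2.9: "these bijections are preserved by arbitrary isomorphisms `γ`").

CONSISTENCY WITNESS / TOY — a DEGENERATE model (`G_K = 1`), NOT the tempered fundamental group of a curve; no side
taken on anything printed.  DEF-BEARING (class (b) MODEL file: no frozen structure touched; instances only on the NEW `TB`).
THE MODEL («twisted Heisenberg ⋊ D_l, times a Tate `ℤ ⊆ Ẑ»), a variant of abc-iut-w5-d118's
`ThetaCoversTemperedModelDefs.lean` designed so that the cusp decomposition group is NOT normal.  Fix an odd `l`.
* `B := (M ⋊ heisPiC l) × ℤ/2` with `M := ℤ/l × ℤ/l` a SECOND copy of the toy's `(b, c)`-plane on which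
  `heisPiC l = (ℤ/l × ℤ/l) ⋊ D_l` acts through its quotient `D_l` (shears and the reflection); `B` is finite
  and discrete, `pr : B → heisPiC l` the projection.
* `Π_C := B × Ẑ` (profinite), `Π^tp_C := B × ℤ`, `Π^tp_C ↪ Π_C` = `id_B × η_ℤ`;
  `Φ := pr ∘ pr₁ : Π_C → heisPiC l`, `Ψ := π_l ∘ pr₂ : Π_C → ℤ/l` (abc-iut-w5-d118's `piL`).
* `G_K := 1`; `Π_X := Φ⁻¹(heisPiX)`, `Δ̄_Θ-preimage := Φ⁻¹(heisTheta)`, `Ker(Δ_X ↠ Δ̄_X) := Φ⁻¹(heisTheta) ∩ Ker Ψ`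
  — verbatim as in the NV-L2 model (every axiom of Def. 2.1 / Rmk. 2.1.1 / Prop. 2.2 (i) is read through `Φ`, `Ψ`);
* NEW: `D_x := ⟨(m₀, η_ℤ(1))⟩`, the cyclic subgroup generated by the translation `m₀ = (1, 0) ∈ M` times the Tate
  generator — still `D_x · Ker = Δ̄_Θ-preimage`, but `tp D_x` is an infinite cyclic subgroup of `Π^tp_C` whose
  normaliser is `Φ⁻¹(ℤ/l × ℤ/l)` (the elements with trivial `D_l`-part), a PROPER normal subgroup.
Proof-only sequels: `Discharge/Sec2TwistedModel{Theta,Tempered}.lean`, `Discharge/Sec2Cor29PreservedClosureRefuted.lean`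
(the inhabitant and the verdict: conjugation by the inversion `ι̲` moves an `Aut_K(C̲)`-orbit of cusps).
[cite: MochizukiEtTh2009, Def 2.1 p.36] [cite: MochizukiEtTh2009, Def 2.5 p.39] [cite: MochizukiEtTh2009, Cor 2.9 p.43]
-/

noncomputable section

namespace Literature.AnabelianGeometry.EtaleTheta

namespace ThetaCovers

namespace TwistedModel

open Multiplicative HeisenbergWitness Literature.AnabelianGeometry.SemiGraphs
  Literature.AnabelianGeometry.EtaleTheta.SettingModel TemperedModel

variable (l : ℕ)

/-! ## 1. The finite factor `B = (M ⋊ heisPiC l) × ℤ/2` -/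

/-- The action of `heisPiC l = (ℤ/l × ℤ/l) ⋊ D_l` on the second copy `M = ℤ/l × ℤ/l` of the `(b, c)`-plane:
through the quotient `D_l` (the toy's `theta`). (toy bookkeeping; no claim about print) [cite: MochizukiEtTh2009, Def 2.5 p.39] -/
def rho : heisPiC l →* MulAut (Multiplicative (ZMod l × ZMod l)) := (theta l).comp SemidirectProduct.rightHom

/-- The twisted Heisenberg group `M ⋊ heisPiC l`. (toy bookkeeping; no claim about print) [cite: MochizukiEtTh2009, Def 2.5 p.39] -/
abbrev TH : Type := Multiplicative (ZMod l × ZMod l) ⋊[rho l] heisPiC l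

/-- The finite factor `B := (M ⋊ heisPiC l) × ℤ/2` of the model's `Π^tp_C = B × ℤ` (a NEW type synonym, so that it
may carry the discrete topology). (toy bookkeeping; no claim about print) [cite: MochizukiEtTh2009, Def 2.5 p.39] -/
def TB : Type := TH l × Multiplicative (ZMod 2)

/-- `B` is a group (the product group). (toy bookkeeping) [cite: MochizukiEtTh2009, Def 2.5 p.39] -/
instance : Group (TB l) := inferInstanceAs (Group (TH l × Multiplicative (ZMod 2)))

/-- `B` carries the DISCRETE topology. (toy bookkeeping) [cite: MochizukiEtTh2009, Def 2.5 p.39] -/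
instance : TopologicalSpace (TB l) := ⊥

/-- `B` is discrete. (toy bookkeeping) [cite: MochizukiEtTh2009, Def 2.5 p.39] -/
instance : DiscreteTopology (TB l) := ⟨rfl⟩

/-- `B` is a topological group (discrete). (toy bookkeeping) [cite: MochizukiEtTh2009, Def 2.5 p.39] -/
instance : IsTopologicalGroup (TB l) where
  continuous_mul := continuous_of_discreteTopology
  continuous_inv := continuous_of_discreteTopology

/-- `B` is finite (`l ≠ 0`). (toy bookkeeping) [cite: MochizukiEtTh2009, Def 2.5 p.39] -/
instance [NeZero l] : Finite (TB l) := by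
  haveI : Finite (heisPiC l) :=
    Finite.of_injective (fun x : heisPiC l => (x.left, x.right))
      fun x y h => SemidirectProduct.ext (Prod.mk.inj h).1 (Prod.mk.inj h).2
  haveI : Finite (TH l) :=
    Finite.of_injective (fun x : TH l => (x.left, x.right))
      fun x y h => SemidirectProduct.ext (Prod.mk.inj h).1 (Prod.mk.inj h).2
  exact inferInstanceAs (Finite (TH l × Multiplicative (ZMod 2)))

/-- Elements of `B` with trivial `M`-part. (toy bookkeeping) [cite: MochizukiEtTh2009, Def 2.5 p.39] -/
def TB.inH (h : heisPiC l) (t : Multiplicative (ZMod 2)) : TB l := (SemidirectProduct.inr h, t)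

/-- The translation `m₀ := (1, 0) ∈ M` as an element of `B`. (toy bookkeeping) [cite: MochizukiEtTh2009, Cor 2.9 p.43] -/
def TB.gen : TB l := (SemidirectProduct.inl (ofAdd ((1 : ZMod l), (0 : ZMod l))), 1)

/-- The Heisenberg component `pr : B → heisPiC l`. (toy bookkeeping) [cite: MochizukiEtTh2009, Def 2.5 p.39] -/
def TB.heis : TB l →* heisPiC l :=
  SemidirectProduct.rightHom.comp (MonoidHom.fst (TH l) (Multiplicative (ZMod 2)))

/-- The `ℤ/2` component `B → ℤ/2` (the `Ċ`/`Ÿ` double-cover coordinate). (toy bookkeeping) [cite: MochizukiEtTh2009, Def 2.5 p.39] -/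
def TB.two : TB l →* Multiplicative (ZMod 2) := MonoidHom.snd (TH l) (Multiplicative (ZMod 2))

/-- `pr (inH h t) = h`. (toy bookkeeping) [cite: MochizukiEtTh2009, Def 2.5 p.39] -/
@[simp] theorem TB.heis_inH (h : heisPiC l) (t : Multiplicative (ZMod 2)) : TB.heis l (TB.inH l h t) = h := rfl

/-- `pr m₀ = 1`. (toy bookkeeping) [cite: MochizukiEtTh2009, Cor 2.9 p.43] -/
@[simp] theorem TB.heis_gen : TB.heis l (TB.gen l) = 1 := rfl

/-! ## 2. The carriers `Π_C = B × Ẑ`, `Π^tp_C = B × ℤ` and the coordinates `Φ`, `Ψ` -/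

/-- `Π_C := B × Ẑ` (`Ẑ` = abc-iut-w5-d118's `TemperedModel.Zhat`). (toy bookkeeping) [cite: MochizukiEtTh2009, Def 2.1 p.36] -/
abbrev PiCB : Type := TB l × Zhat

/-- `Π^tp_C := B × ℤ` (discrete). (toy bookkeeping) [cite: MochizukiEtTh2009, Def 2.5 p.39] -/
abbrev GtpB : Type := TB l × Multiplicative ℤ

/-- `Π^tp_C ↪ Π_C`: `id_B × η_ℤ`. (toy bookkeeping) [cite: MochizukiEtTh2009, Def 2.5 p.39] -/
def toHatB : GtpB l →ₜ* PiCB l := (ContinuousMonoidHom.id (TB l)).prodMap (etaCont (Multiplicative ℤ))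

/-- `Π^tp_C ↪ Π_C` on elements. (toy bookkeeping) [cite: MochizukiEtTh2009, Def 2.5 p.39] -/
@[simp] theorem toHatB_apply (b : TB l) (n : Multiplicative ℤ) :
    toHatB l (b, n) = (b, etaCont (Multiplicative ℤ) n) := rfl

/-- `Φ := pr ∘ pr₁ : Π_C → (ℤ/l × ℤ/l) ⋊ D_l`. (toy bookkeeping) [cite: MochizukiEtTh2009, Def 2.1 p.36] -/
def PhiB : PiCB l →* heisPiC l := (TB.heis l).comp (MonoidHom.fst _ _)

/-- `Φ (b, z) = pr b`. (toy bookkeeping) [cite: MochizukiEtTh2009, Def 2.1 p.36] -/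
@[simp] theorem PhiB_apply (x : PiCB l) : PhiB l x = TB.heis l x.1 := rfl

/-- `Φ^tp := pr ∘ pr₁ : Π^tp_C → (ℤ/l × ℤ/l) ⋊ D_l` (`= Φ ∘ (Π^tp_C ↪ Π_C)`). (toy bookkeeping) [cite: MochizukiEtTh2009, Def 2.5 p.39] -/
def PhiG : GtpB l →* heisPiC l := (TB.heis l).comp (MonoidHom.fst _ _)

/-- `Φ^tp (b, n) = pr b`. (toy bookkeeping) [cite: MochizukiEtTh2009, Def 2.5 p.39] -/
@[simp] theorem PhiG_apply (x : GtpB l) : PhiG l x = TB.heis l x.1 := rfl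

/-- `Φ` is surjective. (toy bookkeeping) [cite: MochizukiEtTh2009, Def 2.1 p.36] -/
theorem PhiB_surjective : Function.Surjective (PhiB l) := fun h => ⟨(TB.inH l h 1, 1), TB.heis_inH l h 1⟩

/-- `Φ` is continuous (preimages of arbitrary subsets are open). (toy bookkeeping) [cite: MochizukiEtTh2009, Def 2.1 p.36] -/
theorem isOpen_preimage_PhiB (S : Set (heisPiC l)) : IsOpen (PhiB l ⁻¹' S) := by
  have : PhiB l ⁻¹' S = (fun x : PiCB l => x.1) ⁻¹' {a | TB.heis l a ∈ S} := rfl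
  rw [this]
  exact (isOpen_discrete _).preimage continuous_fst

/-- … and closed. (toy bookkeeping) [cite: MochizukiEtTh2009, Def 2.1 p.36] -/
theorem isClosed_preimage_PhiB (S : Set (heisPiC l)) : IsClosed (PhiB l ⁻¹' S) := by
  rw [← isOpen_compl_iff, ← Set.preimage_compl]
  exact isOpen_preimage_PhiB l _

/-! ## 3. The subgroups of Def. 2.1 and the NEW cusp decomposition group -/

/-- `Π_X := Φ⁻¹(heisPiX)` (index `2`). (toy bookkeeping) [cite: MochizukiEtTh2009, Def 2.1 p.36] -/
def PiXB : Subgroup (PiCB l) := (heisPiX l).comap (PhiB l)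

/-- `Δ̄_Θ`-preimage `:= Φ⁻¹(heisTheta)`. (toy bookkeeping) [cite: MochizukiEtTh2009, Def 2.1 p.36] -/
def barThetaB : Subgroup (PiCB l) := (heisTheta l).comap (PhiB l)

/-- The generator `(m₀, η_ℤ(1))` of `D_x`: `m₀` times the Tate generator. (toy bookkeeping) [cite: MochizukiEtTh2009, Cor 2.9 p.43] -/
def dxGen : PiCB l := (TB.gen l, etaCont (Multiplicative ℤ) (ofAdd (1 : ℤ)))

/-- **NEW `D_x := ⟨(m₀, η_ℤ(1))⟩`** — cyclic, inside `Δ̄_Θ`-preimage, onto `Δ̄_Θ ≅ ℤ/l` (the Tate direction); its tempered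
trace `⟨(m₀, 1)⟩ ⊆ B × ℤ` is NOT normal. (toy bookkeeping) [cite: MochizukiEtTh2009, Cor 2.9 p.43] -/
def DxB : Subgroup (PiCB l) := Subgroup.zpowers (dxGen l)

/-- `Φ (m₀, η_ℤ 1) = 1`. (toy bookkeeping) [cite: MochizukiEtTh2009, Cor 2.9 p.43] -/
@[simp] theorem PhiB_dxGen : PhiB l (dxGen l) = 1 := by
  simp [dxGen]

/-- `D_x ⊆ Δ̄_Θ`-preimage. (toy bookkeeping) [cite: MochizukiEtTh2009, Cor 2.9 p.43] -/
theorem DxB_le_barThetaB : DxB l ≤ barThetaB l := by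
  rw [DxB, Subgroup.zpowers_le]
  change PhiB l (dxGen l) ∈ heisTheta l
  rw [PhiB_dxGen]
  exact (heisTheta l).one_mem

variable [NeZero l]

/-- `Ψ := π_l ∘ pr₂ : Π_C → ℤ/l` (the Tate direction mod `l`). (toy bookkeeping) [cite: MochizukiEtTh2009, Def 2.1 p.36] -/
def PsiB : PiCB l →* Multiplicative (ZMod l) := (piL l).toMonoidHom.comp (MonoidHom.snd _ _)

/-- `Ψ (x, η_ℤ n) = n mod l`. (toy bookkeeping) [cite: MochizukiEtTh2009, Def 2.1 p.36] -/
@[simp] theorem PsiB_eta (x : TB l) (n : Multiplicative ℤ) :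
    PsiB l (x, etaCont (Multiplicative ℤ) n) = ofAdd ((toAdd n : ℤ) : ZMod l) := by
  simp [PsiB, piL_eta]

/-- `Ψ` is surjective, even on `1 × Ẑ`. (toy bookkeeping) [cite: MochizukiEtTh2009, Def 2.1 p.36] -/
theorem PsiB_surjective_right (y : Multiplicative (ZMod l)) : ∃ z : Zhat, PsiB l (1, z) = y :=
  let ⟨z, hz⟩ := piL_surjective l y; ⟨z, by simpa [PsiB] using hz⟩

/-- `Ker Ψ` is closed. (toy bookkeeping) [cite: MochizukiEtTh2009, Def 2.1 p.36] -/
theorem isClosed_ker_PsiB : IsClosed ((PsiB l).ker : Set (PiCB l)) := by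
  have : ((PsiB l).ker : Set (PiCB l)) = (fun x : PiCB l => piL l x.2) ⁻¹' {1} := by
    ext x; simp [PsiB, MonoidHom.mem_ker]
  rw [this]
  exact (isClosed_discrete _).preimage ((piL l).continuous.comp continuous_snd)

/-- `Ker Ψ` is open. (toy bookkeeping) [cite: MochizukiEtTh2009, Def 2.1 p.36] -/
theorem isOpen_ker_PsiB : IsOpen ((PsiB l).ker : Set (PiCB l)) := by
  have : ((PsiB l).ker : Set (PiCB l)) = (fun x : PiCB l => piL l x.2) ⁻¹' {1} := by
    ext x; simp [PsiB, MonoidHom.mem_ker]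
  rw [this]
  exact (isOpen_discrete _).preimage ((piL l).continuous.comp continuous_snd)

/-- `Ker(Δ_X ↠ Δ̄_X) := Φ⁻¹(heisTheta) ∩ Ker Ψ`. (toy bookkeeping) [cite: MochizukiEtTh2009, Def 2.1 p.36] -/
def barKerB : Subgroup (PiCB l) := barThetaB l ⊓ (PsiB l).ker

/-- `Ψ (m₀, η_ℤ 1) = 1 mod l` (a generator of `ℤ/l`). (toy bookkeeping) [cite: MochizukiEtTh2009, Cor 2.9 p.43] -/
@[simp] theorem PsiB_dxGen : PsiB l (dxGen l) = ofAdd (1 : ZMod l) := by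
  rw [dxGen, PsiB_eta, toAdd_ofAdd, Int.cast_one]

/-- `D_x · Ker = Δ̄_Θ`-preimage (`Ψ(D_x) = ℤ/l`). (toy bookkeeping) [cite: MochizukiEtTh2009, Def 2.1 p.36] -/
theorem DxB_sup_barKerB : DxB l ⊔ barKerB l = barThetaB l := by
  refine le_antisymm (sup_le (DxB_le_barThetaB l) inf_le_left) fun x hx => ?_
  obtain ⟨k, hk⟩ := ZMod.intCast_surjective (toAdd (PsiB l x))
  have hd : dxGen l ^ k ∈ DxB l := Subgroup.zpow_mem _ (Subgroup.mem_zpowers _) k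
  have hΨ : PsiB l (dxGen l ^ k) = PsiB l x := by
    rw [map_zpow, PsiB_dxGen, ← ofAdd_zsmul, zsmul_eq_mul, mul_one, hk, ofAdd_toAdd]
  have hrest : (dxGen l ^ k)⁻¹ * x ∈ barKerB l := by
    refine ⟨Subgroup.mul_mem _ (Subgroup.inv_mem _ (DxB_le_barThetaB l hd)) hx, ?_⟩
    show (dxGen l ^ k)⁻¹ * x ∈ (PsiB l).ker
    rw [MonoidHom.mem_ker, map_mul, map_inv, hΨ, inv_mul_cancel]
  have : x = dxGen l ^ k * ((dxGen l ^ k)⁻¹ * x) := by rw [mul_inv_cancel_left]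
  rw [this]
  exact Subgroup.mul_mem _ (Subgroup.mem_sup_left hd) (Subgroup.mem_sup_right hrest)

/-! ## 4. Toy facts through `Φ` and `Ψ` (verbatim from the NV-L2 model) -/

/-- In the abelian target of `Ψ`, commutators die. (toy bookkeeping) [cite: MochizukiEtTh2009, Def 2.1 p.36] -/
theorem PsiB_comm_mem_ker (x y : PiCB l) : x * y * x⁻¹ * y⁻¹ ∈ (PsiB l).ker := by
  rw [MonoidHom.mem_ker, map_mul, map_mul, map_mul, map_inv, map_inv, mul_inv_cancel_comm, mul_inv_cancel]

/-- `Ψ x ^ l = 1` (`#(ℤ/l) = l`). (toy bookkeeping) [cite: MochizukiEtTh2009, Def 2.1 p.36] -/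
theorem PsiB_pow_l (x : PiCB l) : PsiB l x ^ l = 1 := by
  have h := pow_card_eq_one (G := Multiplicative (ZMod l)) (x := PsiB l x)
  rwa [Fintype.card_multiplicative, ZMod.card] at h

omit [NeZero l] in
/-- `1 × Ẑ ⊆ Δ̄_Θ-preimage` (`Φ (1, z) = 1`). (toy bookkeeping) [cite: MochizukiEtTh2009, Def 2.1 p.36] -/
theorem one_prod_mem_barThetaB (z : Zhat) : ((1 : TB l), z) ∈ barThetaB l := by
  change PhiB l (1, z) ∈ heisTheta l
  rw [PhiB_apply, map_one]
  exact (heisTheta l).one_mem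

/-- `Ψ` restricted to `Δ̄_Θ-preimage` is onto `ℤ/l`. (toy bookkeeping) [cite: MochizukiEtTh2009, Def 2.1 p.36] -/
theorem PsiB_comp_barThetaB_surjective : Function.Surjective ((PsiB l).comp (barThetaB l).subtype) := by
  intro y
  obtain ⟨z, hz⟩ := PsiB_surjective_right l y
  exact ⟨⟨(1, z), one_prod_mem_barThetaB l z⟩, hz⟩

/-- `[Δ̄_Θ-preimage : Ker] = l`. (toy bookkeeping) [cite: MochizukiEtTh2009, Def 2.1 p.36] -/
theorem relIndex_barKerB : (barKerB l).relIndex (barThetaB l) = l := by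
  rw [barKerB, Subgroup.inf_relIndex_left]
  have hker : ((PsiB l).comp (barThetaB l).subtype).ker = (PsiB l).ker.subgroupOf (barThetaB l) := by
    ext x; rfl
  change ((PsiB l).ker.subgroupOf (barThetaB l)).index = l
  rw [← hker, Subgroup.index_ker, MonoidHom.range_eq_top.mpr (PsiB_comp_barThetaB_surjective l),
    Subgroup.card_top, Nat.card_eq_fintype_card, Fintype.card_multiplicative, ZMod.card]

omit [NeZero l] in
/-- Everything lies in the kernel of `Π_C → G_K = 1`. (toy bookkeeping) [cite: MochizukiEtTh2009, Def 2.1 p.36] -/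
theorem mem_ker_oneB (x : PiCB l) : x ∈ (1 : PiCB l →* PUnit.{1}).ker := by
  rw [MonoidHom.mem_ker, MonoidHom.one_apply]

omit [NeZero l] in
/-- The `(a, b)`-coordinates `Δ_X ↠ (ℤ/l)²` (`ellCoords ∘ Φ`). (toy bookkeeping) [cite: MochizukiEtTh2009, Def 2.1 p.36] -/
def ellCoordsB : ↥(PiXB l ⊓ (1 : PiCB l →* PUnit.{1}).ker) →* Multiplicative (ZMod l × ZMod l) :=
  (ellCoords.{0} l).comp
    (((PhiB l).comp (PiXB l ⊓ (1 : PiCB l →* PUnit.{1}).ker).subtype).codRestrict _ fun g =>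
      ⟨g.2.1, mem_ker_one l _⟩)

omit [NeZero l] in
/-- They are onto. (toy bookkeeping) [cite: MochizukiEtTh2009, Def 2.1 p.36] -/
theorem ellCoordsB_surjective : Function.Surjective (ellCoordsB l) := by
  intro y
  obtain ⟨⟨h, hh⟩, rfl⟩ := ellCoords_surjective l y
  obtain ⟨x, hx⟩ := PhiB_surjective l h
  refine ⟨⟨x, ⟨show PhiB l x ∈ heisPiX l by rw [hx]; exact hh.1, mem_ker_oneB l x⟩⟩, ?_⟩
  change ellCoords l ⟨PhiB l x, _⟩ = ellCoords l ⟨h, hh⟩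
  congr 1
  exact Subtype.ext hx

omit [NeZero l] in
/-- Their kernel is `Δ̄_Θ-preimage`. (toy bookkeeping) [cite: MochizukiEtTh2009, Def 2.1 p.36] -/
theorem ellCoordsB_ker : (ellCoordsB l).ker = (barThetaB l).subgroupOf _ := by
  ext g
  rw [MonoidHom.mem_ker, Subgroup.mem_subgroupOf]
  change ellCoords l ⟨PhiB l g, _⟩ = 1 ↔ PhiB l (g : PiCB l) ∈ heisTheta l
  rw [← MonoidHom.mem_ker, ellCoords_ker, Subgroup.mem_subgroupOf]

/-! ## 5. The profinite cover data `CoverDataAx` of the twisted model -/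

/-- **The twisted model's `CoverDataAx`** (Def. 2.1, Rmk. 2.1.1, Prop. 2.2 (i) axioms): `Π_C := B × Ẑ`, `G_K := 1`,
`Π_X := Φ⁻¹(heisPiX)`, `Δ̄_Θ-preimage := Φ⁻¹(heisTheta)`, `Ker(Δ_X ↠ Δ̄_X) := Φ⁻¹(heisTheta) ∩ Ker Ψ`, and the NEW
`D_x := ⟨(m₀, η_ℤ 1)⟩`.  Every axiom is the toy's, read through `Φ`, together with the commutativity of the Tate
direction `Ψ` — verbatim as in abc-iut-w5-d118's `TemperedModel.coverDataAx`, except the three `D_x` fields.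
CONSISTENCY/TOY — not the profinite fundamental group of a curve. [cite: MochizukiEtTh2009, Def 2.1 p.36] -/
abbrev coverDataAx (hl : Odd l) : CoverDataAx.{0} l where
  l_odd := hl
  PiC := PiCB l
  GK := PUnit
  aug := 1
  PiX := PiXB l
  PiX_normal := by
    haveI : (heisPiX l).Normal := MonoidHom.normal_ker _
    exact Subgroup.Normal.comap inferInstance _
  index_PiX := by
    rw [PiXB, Subgroup.index_comap_of_surjective _ (PhiB_surjective l), index_heisPiX]
  isOpen_PiX := by
    change IsOpen ((PhiB l) ⁻¹' (heisPiX l : Set (heisPiC l)))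
    exact isOpen_preimage_PhiB l _
  aug_PiX_surjective := fun _ => ⟨1, Subsingleton.elim _ _⟩
  barKer := barKerB l
  barKer_normal := by
    haveI : (barThetaB l).Normal := (heisTheta_normal l).comap _
    haveI : (PsiB l).ker.Normal := MonoidHom.normal_ker _
    change (barThetaB l ⊓ (PsiB l).ker).Normal
    infer_instance
  isClosed_barKer := by
    change IsClosed (((PhiB l) ⁻¹' (heisTheta l : Set (heisPiC l))) ∩ ((PsiB l).ker : Set (PiCB l)))
    exact (isClosed_preimage_PhiB l _).inter (isClosed_ker_PsiB l)
  barTheta := barThetaB l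
  barTheta_normal := (heisTheta_normal l).comap _
  barKer_le_barTheta := inf_le_left
  barTheta_le := by
    rw [MonoidHom.ker_one, inf_top_eq]
    exact Subgroup.comap_mono (heisTheta_le_heisPiX l)
  relIndex_barKer := relIndex_barKerB l
  ell_rank_two := by
    haveI : (barThetaB l).Normal := (heisTheta_normal l).comap _
    exact ⟨(QuotientGroup.quotientMulEquivOfEq (ellCoordsB_ker l).symm).trans
      (QuotientGroup.quotientKerEquivOfSurjective _ (ellCoordsB_surjective l))⟩
  barTheta_central := by
    intro t ht d hd
    rw [MonoidHom.ker_one, inf_top_eq] at hd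
    refine ⟨?_, PsiB_comm_mem_ker l t d⟩
    change PhiB l (t * d * t⁻¹ * d⁻¹) ∈ heisTheta l
    rw [map_mul, map_mul, map_mul, map_inv, map_inv, heis_central l hl ht hd]
    exact (heisTheta l).one_mem
  Dx := DxB l
  Dx_le := (DxB_le_barThetaB l).trans (Subgroup.comap_mono (heisTheta_le_heisPiX l))
  aug_Dx_surjective := fun _ => ⟨1, Subsingleton.elim _ _⟩
  inertia_sup_barKer := by
    rw [MonoidHom.ker_one, inf_top_eq]
    exact DxB_sup_barKerB l
  pow_mem_barKer := by
    intro d hd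
    rw [MonoidHom.ker_one, inf_top_eq] at hd
    refine ⟨?_, ?_⟩
    · change PhiB l (d ^ l) ∈ heisTheta l
      rw [map_pow, pow_eq_one l hl hd]
      exact (heisTheta l).one_mem
    · show d ^ l ∈ (PsiB l).ker
      rw [MonoidHom.mem_ker, map_pow, PsiB_pow_l]
  inv_ell := by
    intro c _ hc d hd
    rw [MonoidHom.ker_one, inf_top_eq] at hd
    change PhiB l (c * d * c⁻¹ * d) ∈ heisTheta l
    rw [map_mul, map_mul, map_mul, map_inv]
    exact heis_inv_ell l hl hc hd
  inv_theta := by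
    intro c _ hc t ht
    refine ⟨?_, PsiB_comm_mem_ker l c t⟩
    change PhiB l (c * t * c⁻¹ * t⁻¹) ∈ heisTheta l
    rw [map_mul, map_mul, map_mul, map_inv, map_inv, heis_inv_theta l hl hc ht]
    exact (heisTheta l).one_mem

/-! ## 6. The data of the orbicurve `C̲̲` (Def. 2.3) and of the tempered layer (Def. 2.5) — properties in parts 2–3 -/

omit [NeZero l] in
/-- `Π_C̲ := Φ⁻¹(heisPiCu)` — the toy's `(ℤ/l × ℤ/l) ⋊ {1, s}` pulled back. (toy bookkeeping) [cite: MochizukiEtTh2009, Def 2.1 p.36] -/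
def HpB : Subgroup (PiCB l) := (heisPiCu l).comap (PhiB l)

omit [NeZero l] in
/-- The inversion `ι̲ := ((s, 1), 1)` (`s = s r⁰`). (toy bookkeeping) [cite: MochizukiEtTh2009, Prop 2.2 p.36] -/
def iotaB : PiCB l := (TB.inH l (SemidirectProduct.inr (DihedralGroup.sr 0)) 1, 1)

/-- `E := (Π_C̲ ∩ Π_X) ∩ Ker Ψ` (`Im(s_ι)` of Prop. 2.2 (i)). (toy bookkeeping) [cite: MochizukiEtTh2009, Prop 2.2 (i) p.37] -/
def EB : Subgroup (PiCB l) := (HpB l ⊓ PiXB l) ⊓ (PsiB l).ker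

/-- `Π_C̲̲ := (S · E) · ⟨ι̲⟩`, `S := Ker(Δ_X ↠ Δ̄_X)` (Def. 2.3). (toy bookkeeping) [cite: MochizukiEtTh2009, Def 2.3 p.38] -/
def PiCuuB : Subgroup (PiCB l) := (barKerB l ⊔ EB l) ⊔ Subgroup.zpowers (iotaB l)

omit [NeZero l] in
/-- `B_X := pr⁻¹(heisPiX) ⊆ B` (the `Π^tp_X`-part of the finite factor). (toy bookkeeping) [cite: MochizukiEtTh2009, Def 2.5 p.39] -/
def TBX : Subgroup (TB l) := (heisPiX l).comap (TB.heis l)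

omit [NeZero l] in
/-- The tempered inversion `ι̲ = ((s, 1), 0) ∈ Π^tp_C = B × ℤ` (maps to `iotaB`). (toy bookkeeping) [cite: MochizukiEtTh2009, Prop 2.2 p.36] -/
def iotaG : GtpB l := (TB.inH l (SemidirectProduct.inr (DihedralGroup.sr 0)) 1, 1)

omit [NeZero l] in
/-- The tempered generator `g₀ = (m₀, 1) ∈ Π^tp_C` of `tp D_x`. (toy bookkeeping) [cite: MochizukiEtTh2009, Cor 2.9 p.43] -/
def genG : GtpB l := (TB.gen l, ofAdd (1 : ℤ))

omit [NeZero l] in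
/-- `toHat ι̲^tp = ι̲`. (toy bookkeeping) [cite: MochizukiEtTh2009, Prop 2.2 p.36] -/
theorem toHatB_iotaG : toHatB l (iotaG l) = iotaB l := by
  rw [iotaG, toHatB_apply, map_one]; rfl

omit [NeZero l] in
/-- `toHat g₀ = (m₀, η_ℤ 1)`. (toy bookkeeping) [cite: MochizukiEtTh2009, Cor 2.9 p.43] -/
theorem toHatB_genG : toHatB l (genG l) = dxGen l := rfl

end TwistedModel

end ThetaCovers

end Literature.AnabelianGeometry.EtaleTheta
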